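import Summits.CriticalPhenomena.PercolationContinuityZ3.Theorems.PercNearOneGluingNoHeavyLowerTailSahiGridPatternTwoCylinders
import Summits.CriticalPhenomena.PercolationContinuityZ3.Theorems.PercNearOneGluingNoHeavyLowerTailSahiGridPatternBlockRestrict
import Summits.CriticalPhenomena.PercolationContinuityZ3.Theorems.PercNearOneGluingNoHeavyLowerTailSahiGridPatternBlockProduct

/-!
# `NoHeavyLowerTail` (crux stmt-CriticalPhenomena-4575), Sahi programme: **TWO SLOTS ON THE SAME THREE COORDINATES — a new face of the pattern
# inequality in every dimension (kernel), with its grid / product-measure form**; block products over small blocks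

Support file (seat `prim-sahi-p1`, generation 10; `--supports stmt-CriticalPhenomena-4575`).  Pure proofs, no definitions, no `sorry`, standard axioms.
Assembles `…SahiGridPatternTwoCylinders` (`sStarD_nonneg_of_twoCylinders`: for two `J`-measurable slots, `J`-measurable test sets suffice),
`…SahiGridPatternBlockRestrict` (`sStarD_measurable_nonneg_of_card_le_three`, `…_of_patternPos`: cylinder triples over a block reduce to the block) and
`…SahiGridPatternBlockProduct` (`sStarD_nonneg_of_blockProduct`).

* **`sStarD_nonneg_of_twoSlots_card_le_three`** (every `d`): if the up-sets `A, B ⊆ [3]^d` are both measurable w.r.t. a common set `J` of at most THREE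
  coordinates, then `0 ≤ sStarD A B C` for EVERY up-set `C` — kernel (`PatternPos 3` via the 226 slice certificates of generation 7, no `native_decide`).
  (`|J| ≤ 2`: one such slot suffices, `…TwoCoord`; `|J| = 4`: certificate-grade via PatternPos 4.)  General form `sStarD_nonneg_of_twoSlots_of_patternPos`
  (hypothesis `PatternPos |J|`).
* GRID FORM **`latticeE3_gridProd_nonneg_twoSlots`**, **`sahiE_three_twoSlots_nonneg`**: for every product weight on every grid `[K+1]^d`, if two of the three increasing
  events are measurable w.r.t. the same `≤ 3` axes and the third is an arbitrary increasing event, then `Z³E₃ ≥ 0` / `E₃(1_A,1_B,1_C) ≥ 0` — coefficientwise.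
  (At the measure level this follows from the three-dimensional theorem `W(3,3)` by conditioning on the block and a layer cake; the coefficientwise statement is
  the content.)
* **`sStarD_nonneg_of_blockProduct_of_patternPos`**: block products `(A′∩A″, B′∩B″, C′∩C″)` of up-sets with `A′,B′,C′` `J`-measurable and `A″,B″,C″`
  `Jᶜ`-measurable are good as soon as `PatternPos |J|` and `PatternPos |Jᶜ|` hold — e.g. unconditionally for `|J|, |Jᶜ| ≤ 3` (`…_card_le_three`).
HONEST LABEL: `PatternPos d` (`d ≥ 4` kernel, `≥ 5` at all), Sahi's `C₃` and Kahn's conjecture remain OPEN; nothing here asserts them. [this work]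
-/

noncomputable section

open Finset
open scoped Classical

namespace Summit.CriticalPhenomena.PercolationContinuityZ3.Theorems.SahiGridPattern

open Literature.Probability.LatticeModels Literature.Combinatorics.Sahi2008
open SahiGrid3 (ind)

variable {d K : ℕ}

/-! ### Two slots on a common small block -/

/-- **Two slots measurable w.r.t. a common block on which `PatternPos` holds are good against every up-set** (every `d`). [this work] -/
theorem sStarD_nonneg_of_twoSlots_of_patternPos (J : Finset (Fin d)) (hP : PatternPos J.card) {A B : Finset (Pd d)}
    (hAu : IsUpperSet (A : Set (Pd d))) (hBu : IsUpperSet (B : Set (Pd d)))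
    (hA : ∀ x y : Pd d, (∀ a ∈ J, x a = y a) → (x ∈ A ↔ y ∈ A)) (hB : ∀ x y : Pd d, (∀ a ∈ J, x a = y a) → (x ∈ B ↔ y ∈ B))
    (C : Finset (Pd d)) (hC : IsUpperSet (C : Set (Pd d))) : 0 ≤ sStarD A B C :=
  sStarD_nonneg_of_twoCylinders J hA hB (fun _ hU hUJ => sStarD_measurable_nonneg_of_patternPos J hP hAu hBu hU hA hB hUJ) C hC

/-- **TWO SLOTS ON THE SAME ≤ 3 COORDINATES, EVERY DIMENSION (kernel).**  If the up-sets `A, B ⊆ [3]^d` are both measurable w.r.t. a common set of at most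
three coordinates, then `0 ≤ sStarD A B C` for every up-set `C`. [this work] -/
theorem sStarD_nonneg_of_twoSlots_card_le_three (J : Finset (Fin d)) (hJ : J.card ≤ 3) {A B : Finset (Pd d)}
    (hAu : IsUpperSet (A : Set (Pd d))) (hBu : IsUpperSet (B : Set (Pd d)))
    (hA : ∀ x y : Pd d, (∀ a ∈ J, x a = y a) → (x ∈ A ↔ y ∈ A)) (hB : ∀ x y : Pd d, (∀ a ∈ J, x a = y a) → (x ∈ B ↔ y ∈ B))
    (C : Finset (Pd d)) (hC : IsUpperSet (C : Set (Pd d))) : 0 ≤ sStarD A B C :=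
  sStarD_nonneg_of_twoCylinders J hA hB (fun _ hU hUJ => sStarD_measurable_nonneg_of_card_le_three J hJ hAu hBu hU hA hB hUJ) C hC

/-- Slot-permuted form (slots `1, 3` on the common block). [this work] -/
theorem sStarD_nonneg_of_twoSlots_card_le_three₁₃ (J : Finset (Fin d)) (hJ : J.card ≤ 3) {A B C : Finset (Pd d)}
    (hAu : IsUpperSet (A : Set (Pd d))) (hBu : IsUpperSet (B : Set (Pd d))) (hCu : IsUpperSet (C : Set (Pd d)))
    (hA : ∀ x y : Pd d, (∀ a ∈ J, x a = y a) → (x ∈ A ↔ y ∈ A)) (hC : ∀ x y : Pd d, (∀ a ∈ J, x a = y a) → (x ∈ C ↔ y ∈ C)) :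
    0 ≤ sStarD A B C := by
  rw [sStarD_swap23]; exact sStarD_nonneg_of_twoSlots_card_le_three J hJ hAu hCu hA hC B hBu

/-- Slot-permuted form (slots `2, 3` on the common block). [this work] -/
theorem sStarD_nonneg_of_twoSlots_card_le_three₂₃ (J : Finset (Fin d)) (hJ : J.card ≤ 3) {A B C : Finset (Pd d)}
    (hAu : IsUpperSet (A : Set (Pd d))) (hBu : IsUpperSet (B : Set (Pd d))) (hCu : IsUpperSet (C : Set (Pd d)))
    (hB : ∀ x y : Pd d, (∀ a ∈ J, x a = y a) → (x ∈ B ↔ y ∈ B)) (hC : ∀ x y : Pd d, (∀ a ∈ J, x a = y a) → (x ∈ C ↔ y ∈ C)) :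
    0 ≤ sStarD A B C := by
  rw [sStarD_swap12, sStarD_swap23]; exact sStarD_nonneg_of_twoSlots_card_le_three J hJ hBu hCu hB hC A hAu

/-! ### Grid form -/

/-- **The symmetrised pattern value is nonnegative** at every three-point sample of the grid when two of the three up-sets are measurable w.r.t. a common set
of `≤ 3` axes. [this work] -/
theorem Ssym_nonneg_twoSlots (J : Finset (Fin d)) (hJ : J.card ≤ 3) {A B C : Finset (Xd d K)} (hA : IsUpperSet (A : Set (Xd d K)))
    (hB : IsUpperSet (B : Set (Xd d K))) (hC : IsUpperSet (C : Set (Xd d K)))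
    (hAJ : ∀ x y : Xd d K, (∀ a ∈ J, x a = y a) → (x ∈ A ↔ y ∈ A)) (hBJ : ∀ x y : Xd d K, (∀ a ∈ J, x a = y a) → (x ∈ B ↔ y ∈ B))
    (ω : Fin 3 → Xd d K) : 0 ≤ Ssym A B C ω := by
  let σ : Fin d → Equiv.Perm (Fin 3) := fun a => Tuple.sort fun c => ω c a
  have hsort : ∀ a, Monotone fun c => Tmap σ ω c a := fun a => by
    show Monotone ((fun c => ω c a) ∘ σ a)
    exact Tuple.monotone_sort _
  rw [← S_Tmap A B C σ ω, S_eq_sStarD]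
  set ω' : Fin 3 → Xd d K := Tmap σ ω with hω'
  have hmeas : ∀ {X : Finset (Xd d K)}, (∀ x y : Xd d K, (∀ a ∈ J, x a = y a) → (x ∈ X ↔ y ∈ X)) →
      ∀ p q : Pd d, (∀ a ∈ J, p a = q a) → (p ∈ pb ω' X ↔ q ∈ pb ω' X) := by
    intro X hX p q hpq
    unfold pb
    rw [Finset.mem_filter, Finset.mem_filter]
    simp only [Finset.mem_univ, true_and]
    refine hX _ _ fun a ha => ?_
    show ω' (p a) a = ω' (q a) a
    rw [hpq a ha]
  exact sStarD_nonneg_of_twoSlots_card_le_three J hJ (isUpperSet_pb hsort hA) (isUpperSet_pb hsort hB) (hmeas hAJ) (hmeas hBJ) _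
    (isUpperSet_pb hsort hC)

/-- **SAHI'S `E₃ ≥ 0` WHEN TWO EVENTS LIVE ON THE SAME THREE AXES, COEFFICIENTWISE ON EVERY GRID, homogeneous form** (every `d`, `K`): for every nonnegative
product weight on `[K+1]^d`, up-sets `A, B` measurable w.r.t. a common set of `≤ 3` axes and an arbitrary up-set `C`: `0 ≤ latticeE3 w A B C`. [this work] -/
theorem latticeE3_gridProd_nonneg_twoSlots (g : Fin d → Fin (K + 1) → ℝ) (hg : ∀ a u, 0 ≤ g a u) (J : Finset (Fin d)) (hJ : J.card ≤ 3)
    {A B C : Finset (Xd d K)} (hA : IsUpperSet (A : Set (Xd d K))) (hB : IsUpperSet (B : Set (Xd d K))) (hC : IsUpperSet (C : Set (Xd d K)))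
    (hAJ : ∀ x y : Xd d K, (∀ a ∈ J, x a = y a) → (x ∈ A ↔ y ∈ A)) (hBJ : ∀ x y : Xd d K, (∀ a ∈ J, x a = y a) → (x ∈ B ↔ y ∈ B)) :
    0 ≤ latticeE3 (fun ω : Xd d K => ∏ a, g a (ω a)) A B C := by
  have hcard : (0 : ℝ) < Fintype.card (Fin d → Equiv.Perm (Fin 3)) := by exact_mod_cast Fintype.card_pos
  have h := latticeE3_symm g A B C
  have hsum : 0 ≤ ∑ ω : Fin 3 → Xd d K, (∏ c, ∏ a, g a (ω c a)) * (Ssym A B C ω : ℝ) :=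
    Finset.sum_nonneg fun ω _ => mul_nonneg (Finset.prod_nonneg fun c _ => Finset.prod_nonneg fun a _ => hg a _)
      (by exact_mod_cast Ssym_nonneg_twoSlots J hJ hA hB hC hAJ hBJ ω)
  rw [← h] at hsum
  exact (mul_nonneg_iff_of_pos_left hcard).1 hsum

/-- **SAHI'S `E₃ ≥ 0` WHEN TWO EVENTS LIVE ON THE SAME THREE AXES, probability form** (every `d`, `K`): for every product probability weight on `[K+1]^d`,
increasing events `A, B` measurable w.r.t. a common set of at most three axes and an arbitrary increasing event `C`: `0 ≤ E₃(1_A, 1_B, 1_C)`. [this work] -/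
theorem sahiE_three_twoSlots_nonneg (g : Fin d → Fin (K + 1) → ℝ) (hg0 : ∀ i u, 0 ≤ g i u) (hg1 : ∀ i, ∑ u, g i u = 1)
    (J : Finset (Fin d)) (hJ : J.card ≤ 3) {A B C : Finset (Xd d K)} (hA : IsUpperSet (A : Set (Xd d K))) (hB : IsUpperSet (B : Set (Xd d K)))
    (hC : IsUpperSet (C : Set (Xd d K))) (hAJ : ∀ x y : Xd d K, (∀ a ∈ J, x a = y a) → (x ∈ A ↔ y ∈ A))
    (hBJ : ∀ x y : Xd d K, (∀ a ∈ J, x a = y a) → (x ∈ B ↔ y ∈ B)) :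
    0 ≤ sahiE (fun ω : Xd d K => ∏ i, g i (ω i)) 3 ![setInd A, setInd B, setInd C] := by
  have hsum : ∑ ω : Fin d → Fin (K + 1), ∏ i, g i (ω i) = 1 := by
    rw [← Fintype.prod_sum]; simp [hg1]
  rw [sahiE_three_indicator_eq_latticeE3 hsum]
  exact latticeE3_gridProd_nonneg_twoSlots g hg0 J hJ hA hB hC hAJ hBJ

/-! ### Block products over blocks carrying `PatternPos` -/

/-- **Block products are good when `PatternPos` holds on both blocks** (every `d`, `J`; e.g. unconditionally when `|J| ≤ 3` and `|Jᶜ| ≤ 3`). [this work] -/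
theorem sStarD_nonneg_of_blockProduct_of_patternPos (J : Finset (Fin d)) (hP : PatternPos J.card) (hP' : PatternPos (univ \ J).card)
    {A' B' C' A'' B'' C'' : Finset (Pd d)}
    (hA'u : IsUpperSet (A' : Set (Pd d))) (hB'u : IsUpperSet (B' : Set (Pd d))) (hC'u : IsUpperSet (C' : Set (Pd d)))
    (hA''u : IsUpperSet (A'' : Set (Pd d))) (hB''u : IsUpperSet (B'' : Set (Pd d))) (hC''u : IsUpperSet (C'' : Set (Pd d)))
    (hA' : ∀ x y : Pd d, (∀ a ∈ J, x a = y a) → (x ∈ A' ↔ y ∈ A'))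
    (hB' : ∀ x y : Pd d, (∀ a ∈ J, x a = y a) → (x ∈ B' ↔ y ∈ B'))
    (hC' : ∀ x y : Pd d, (∀ a ∈ J, x a = y a) → (x ∈ C' ↔ y ∈ C'))
    (hA'' : ∀ x y : Pd d, (∀ a ∉ J, x a = y a) → (x ∈ A'' ↔ y ∈ A''))
    (hB'' : ∀ x y : Pd d, (∀ a ∉ J, x a = y a) → (x ∈ B'' ↔ y ∈ B''))
    (hC'' : ∀ x y : Pd d, (∀ a ∉ J, x a = y a) → (x ∈ C'' ↔ y ∈ C'')) :
    0 ≤ sStarD (A' ∩ A'') (B' ∩ B'') (C' ∩ C'') := by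
  have hc : ∀ {X : Finset (Pd d)}, (∀ x y : Pd d, (∀ a ∉ J, x a = y a) → (x ∈ X ↔ y ∈ X)) →
      ∀ x y : Pd d, (∀ a ∈ univ \ J, x a = y a) → (x ∈ X ↔ y ∈ X) :=
    fun hX x y h => hX x y fun a ha => h a (Finset.mem_sdiff.2 ⟨Finset.mem_univ _, ha⟩)
  exact sStarD_nonneg_of_blockProduct J hA'u hB'u hC'u hA''u hB''u hC''u hA' hB' hC' hA'' hB'' hC''
    (sStarD_measurable_nonneg_of_patternPos J hP hA'u hB'u hC'u hA' hB' hC')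
    (sStarD_measurable_nonneg_of_patternPos (univ \ J) hP' hA''u hB''u hC''u (hc hA'') (hc hB'') (hc hC''))

/-- **Block products over two blocks of at most three axes each are good** (unconditional; `d ≤ 6`). [this work] -/
theorem sStarD_nonneg_of_blockProduct_card_le_three (J : Finset (Fin d)) (hJ : J.card ≤ 3) (hJ' : (univ \ J).card ≤ 3)
    {A' B' C' A'' B'' C'' : Finset (Pd d)}
    (hA'u : IsUpperSet (A' : Set (Pd d))) (hB'u : IsUpperSet (B' : Set (Pd d))) (hC'u : IsUpperSet (C' : Set (Pd d)))
    (hA''u : IsUpperSet (A'' : Set (Pd d))) (hB''u : IsUpperSet (B'' : Set (Pd d))) (hC''u : IsUpperSet (C'' : Set (Pd d)))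
    (hA' : ∀ x y : Pd d, (∀ a ∈ J, x a = y a) → (x ∈ A' ↔ y ∈ A'))
    (hB' : ∀ x y : Pd d, (∀ a ∈ J, x a = y a) → (x ∈ B' ↔ y ∈ B'))
    (hC' : ∀ x y : Pd d, (∀ a ∈ J, x a = y a) → (x ∈ C' ↔ y ∈ C'))
    (hA'' : ∀ x y : Pd d, (∀ a ∉ J, x a = y a) → (x ∈ A'' ↔ y ∈ A''))
    (hB'' : ∀ x y : Pd d, (∀ a ∉ J, x a = y a) → (x ∈ B'' ↔ y ∈ B''))
    (hC'' : ∀ x y : Pd d, (∀ a ∉ J, x a = y a) → (x ∈ C'' ↔ y ∈ C'')) :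
    0 ≤ sStarD (A' ∩ A'') (B' ∩ B'') (C' ∩ C'') :=
  sStarD_nonneg_of_blockProduct_of_patternPos J (patternPos_of_le hJ fun X Y Z hX hY hZ => sStarD_three_nonneg X Y Z hX hY hZ)
    (patternPos_of_le hJ' fun X Y Z hX hY hZ => sStarD_three_nonneg X Y Z hX hY hZ)
    hA'u hB'u hC'u hA''u hB''u hC''u hA' hB' hC' hA'' hB'' hC''

end Summit.CriticalPhenomena.PercolationContinuityZ3.Theorems.SahiGridPattern
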